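import Summits.MatrixMultiplication.MatrixMultiplication.Theorems.OutsiderSandwichCwCubeSubrank
import Summits.MatrixMultiplication.MatrixMultiplication.Theorems.OutsiderSandwichHalfMMFinite
import Summits.MatrixMultiplication.MatrixMultiplication.Theorems.CwCubeHostsMMThree

/-!
# Packing FLOORS for `cw₂^{⊠N}`: the constructive side of the K38 census

Generation 38, Part IV, of `decomp-mm-lens-4` ("minimal-counterexample / extremal reduction") for
`route-MatrixMultiplication-OutsiderSandwich`; helper → `LaserTangency` (stmt-32268).  Imports no
`Theses` file.

Parts I–II (`OutsiderSandwichPackingSlack`, `OutsiderSandwichPencil*`) are CEILINGS: `F·⟨m,m,m⟩ ≤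
cw₂^{⊠N} ⟹ F ≤ c(N,m)`.  Part III (`OutsiderSandwichCwCubeSubrank`) gave the diagonals `⟨13⟩ ≤
cw₂^{⊠3}` (every field) and `⟨14⟩ ≤ cw₂^{⊠3}` (over `ℂ`).  This file turns diagonals into FLOORS
`F·⟨m,m,m⟩ ≤ cw₂^{⊠N}` by two transports,

* `cw₂^{⊠N} ≥ ⟨2F⟩ ⟹ cw₂^{⊠(N+1)} ≥ F·⟨2,2,2⟩` (half a matrix product per copy of `cw₂`,
  `CwCubeHostsMMThree.mmTwo_le_unitTwo_kronecker_cwTwo`: `⟨2⟩ ⊠ cw₂ ≥ ⟨2,2,2⟩`),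
* `cw₂^{⊠N} ≥ ⟨F⟩`, `cw₂^{⊠M} ≥ ⟨m,m,m⟩ ⟹ cw₂^{⊠(N+M)} ≥ F·⟨m,m,m⟩`,

fed with `⟨2⟩ ≤ cw₂`, `⟨6⟩ ≤ cw₂^{⊠2}`, `⟨14⟩ ≤ cw₂^{⊠3}`, `⟨36⟩ ≤ cw₂^{⊠4}`, `⟨84⟩ ≤ cw₂^{⊠5}`
and `I(2,2)`, `I(3,3)`.  Resulting two-sided census windows over `ℂ` (floor from this file ‖ ceiling
from Parts I–II):

| `(N,m)` | (3,2) | (4,2) | (5,2) | (6,2) | (4,3) | (5,3) | (6,3) | (7,3) | (5,4) | (6,4) |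
|---|---|---|---|---|---|---|---|---|---|---|
| floor `F ≥` | 3 | 7 | 18 | 42 | 2 | 6 | 14 | 36 | 2 | 6 |
| ceiling `F ≤` | 5 | 17 | 55 | 170 | 7 | 24 | 75 | 232 | 13 | 42 |

and the single-matrix floors `⟨4,4,4⟩ ≤ cw₂^{⊠4}`, `⟨6,6,6⟩ ≤ cw₂^{⊠5}`, `⟨9,9,9⟩ ≤ cw₂^{⊠6}`
(ceilings `8`, `15`, `26`).  Every floor is a product of smaller cells — the honest statement of
where constructions stand: NO cell beyond products is known from below except Part III's `13, 14 >
12 = 6·2` at `N = 3`.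

References: Coppersmith–Winograd 1990 §6 (`cw₂`); Christandl–Vrana–Zuiddam, J. Amer. Math. Soc. 36
(2023) §1.1 (`Q(cw_q^{⊠N})`, zeroing-out diagonals); Conner–Gesmundo–Landsberg–Ventura 2022, eq. (1)
(`R(⊕_F ⟨m,m,m⟩) ≤ R(cw_q^{⊠N})`, the packing shape); Bläser 2013 §5.2 (`⟨k,m,n⟩ ⊠ ⟨k',m',n'⟩ =
⟨kk',mm',nn'⟩`).
-/

set_option linter.dupNamespace false

namespace Summit.MatrixMultiplication.MatrixMultiplication.Theorems.OutsiderSandwichPackFloors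

open Literature.Computability.AlgebraicComplexity
open Summit.MatrixMultiplication.MatrixMultiplication.Theorems.OutsiderSandwichDegenerationWitness
  (cwPow_add_restrictsTo mm_mul cwTwo_restrictsTo_unitTwo kroneckerPow_one_restrictsTo
    kronecker_unitTensor_restrictsTo)
open Summit.MatrixMultiplication.MatrixMultiplication.Theorems.OutsiderSandwichHalfMM
  (mmInCwTwoPow_two_two unitTensor_mul_restrictsTo)
open Summit.MatrixMultiplication.MatrixMultiplication.Theorems.CwCubeHostsMMThree
  (mmTwo_le_unitTwo_kronecker_cwTwo mmInCwTwoPow_three_three)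
open Summit.MatrixMultiplication.MatrixMultiplication.Theorems.OutsiderSandwichCwCubeSubrank
  (cwPow_restrictsTo_unitTensor_of_cert cwPow_three_restrictsTo_unitFourteen)

/-! ## 1. Transports -/

/-- `(A ⊠ B) ⊠ C ≥ A ⊠ (B ⊠ C)` (re-bracketing, a relabelling). [folklore] -/
theorem kronecker_assoc_restrictsTo {ι₁ κ₁ μ₁ ι₂ κ₂ μ₂ ι₃ κ₃ μ₃ : Type} [Fintype ι₁] [Fintype κ₁]
    [Fintype μ₁] [Fintype ι₂] [Fintype κ₂] [Fintype μ₂] [Fintype ι₃] [Fintype κ₃] [Fintype μ₃]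
    (A : ι₁ → κ₁ → μ₁ → ℂ) (B : ι₂ → κ₂ → μ₂ → ℂ) (C : ι₃ → κ₃ → μ₃ → ℂ) :
    TensorRestrictsTo (kroneckerTensor (kroneckerTensor A B) C)
      (kroneckerTensor A (kroneckerTensor B C)) := by
  classical
  have e : kroneckerTensor A (kroneckerTensor B C) = fun a b c =>
      kroneckerTensor (kroneckerTensor A B) C ((a.1, a.2.1), a.2.2) ((b.1, b.2.1), b.2.2)
        ((c.1, c.2.1), c.2.2) := by
    funext a b c
    simp only [kroneckerTensor_apply, mul_assoc]
  rw [e]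
  exact tensorRestrictsTo_precomp _ _ _ _

/-- **Half-MM transport**: `cw₂^{⊠N} ≥ ⟨F·2⟩ ⟹ cw₂^{⊠(N+1)} ≥ F·⟨2,2,2⟩`
(`cw₂^{⊠(N+1)} ≥ cw₂^{⊠N} ⊠ cw₂ ≥ (⟨F⟩ ⊠ ⟨2⟩) ⊠ cw₂ ≥ ⟨F⟩ ⊠ (⟨2⟩ ⊠ cw₂) ≥ ⟨F⟩ ⊠ ⟨2,2,2⟩`).
[cite: ConnerGesmundoLandsbergVentura2022, eq. (1)] -/
theorem pack_two_of_diagonal {N F : ℕ}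
    (h : TensorRestrictsTo (kroneckerPow (cwTensor ℂ 2) N) (unitTensor ℂ (F * 2))) :
    TensorRestrictsTo (kroneckerPow (cwTensor ℂ 2) (N + 1))
      (kroneckerTensor (unitTensor ℂ F) (matMulTensor ℂ 2 2 2)) :=
  (cwPow_add_restrictsTo N 1).trans <|
    ((h.trans (unitTensor_mul_restrictsTo F 2)).kronecker (kroneckerPow_one_restrictsTo _)).trans <|
      (kronecker_assoc_restrictsTo _ _ _).trans <|
        (TensorRestrictsTo.refl _).kronecker (mmTwo_le_unitTwo_kronecker_cwTwo ℂ)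

/-- **Product transport**: `cw₂^{⊠N} ≥ ⟨F⟩` and `cw₂^{⊠M} ≥ ⟨m,m,m⟩ ⟹ cw₂^{⊠(N+M)} ≥ F·⟨m,m,m⟩`.
[cite: ConnerGesmundoLandsbergVentura2022, eq. (1)] -/
theorem pack_of_diagonal_of_mm {N M F m : ℕ}
    (h : TensorRestrictsTo (kroneckerPow (cwTensor ℂ 2) N) (unitTensor ℂ F))
    (h' : TensorRestrictsTo (kroneckerPow (cwTensor ℂ 2) M) (matMulTensor ℂ m m m)) :
    TensorRestrictsTo (kroneckerPow (cwTensor ℂ 2) (N + M))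
      (kroneckerTensor (unitTensor ℂ F) (matMulTensor ℂ m m m)) :=
  (cwPow_add_restrictsTo N M).trans (h.kronecker h')

/-- **Diagonal product**: `cw₂^{⊠N} ≥ ⟨F⟩`, `cw₂^{⊠M} ≥ ⟨F'⟩ ⟹ cw₂^{⊠(N+M)} ≥ ⟨F·F'⟩`
(`Q` is super-multiplicative). [cite: ChristandlVranaZuiddam2023, §1.1] -/
theorem diagonal_mul {N M F F' : ℕ}
    (h : TensorRestrictsTo (kroneckerPow (cwTensor ℂ 2) N) (unitTensor ℂ F))
    (h' : TensorRestrictsTo (kroneckerPow (cwTensor ℂ 2) M) (unitTensor ℂ F')) :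
    TensorRestrictsTo (kroneckerPow (cwTensor ℂ 2) (N + M)) (unitTensor ℂ (F * F')) :=
  ((cwPow_add_restrictsTo N M).trans (h.kronecker h')).trans (kronecker_unitTensor_restrictsTo F F')

/-! ## 2. Diagonals: `⟨2⟩ ≤ cw₂`, `⟨6⟩ ≤ cw₂^{⊠2}`, `⟨36⟩ ≤ cw₂^{⊠4}`, `⟨84⟩ ≤ cw₂^{⊠5}`,
`⟨216⟩ ≤ cw₂^{⊠6}` -/

/-- `cw₂^{⊠1} ≥ ⟨2⟩`. [cite: CoppersmithWinograd1990, §11] -/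
theorem cwPow_one_restrictsTo_unitTwo :
    TensorRestrictsTo (kroneckerPow (cwTensor ℂ 2) 1) (unitTensor ℂ 2) :=
  (kroneckerPow_one_restrictsTo _).trans cwTwo_restrictsTo_unitTwo

/-- `cw₂^{⊠2} ≥ ⟨6⟩` over `ℂ` — the `ℂ`-instance of the zeroing-out certificate of
`SoloInformedCwTwoSubrank.tensorRestrictsTo_kroneckerPow_cwTensor_two_two_unitTensor_six` (every
field; that module is outside this file's import closure), re-derived from the Part III certificate
lemma with the word tables below (rows `x | y | z`, six words of length `2`).
[cite: ChristandlVranaZuiddam2023, §1.1] -/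
theorem cwPow_two_restrictsTo_unitSix_complex :
    TensorRestrictsTo (kroneckerPow (cwTensor ℂ 2) 2) (unitTensor ℂ 6) :=
  cwPow_restrictsTo_unitTensor_of_cert
    (![![0, 1], ![0, 2], ![1, 0], ![1, 1], ![2, 0], ![2, 2]] : Fin 6 → Fin 2 → Fin 3)
    (![![2, 0], ![1, 2], ![0, 2], ![0, 0], ![2, 1], ![2, 2]] : Fin 6 → Fin 2 → Fin 3)
    (![![2, 1], ![1, 0], ![1, 2], ![1, 1], ![0, 1], ![0, 0]] : Fin 6 → Fin 2 → Fin 3)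
    (by decide)

/-- `cw₂^{⊠4} ≥ ⟨36⟩` (`= ⟨6⟩ ⊠ ⟨6⟩`; the product floor at `N = 4`, ceiling `73`,
`OutsiderSandwichPackingSlack.subrank_window`). [cite: ChristandlVranaZuiddam2023, §1.1] -/
theorem cwPow_four_restrictsTo_unitThirtySix :
    TensorRestrictsTo (kroneckerPow (cwTensor ℂ 2) 4) (unitTensor ℂ 36) :=
  diagonal_mul cwPow_two_restrictsTo_unitSix_complex cwPow_two_restrictsTo_unitSix_complex

/-- `cw₂^{⊠5} ≥ ⟨84⟩` (`= ⟨14⟩ ⊠ ⟨6⟩`; ceiling `227`). [cite: ChristandlVranaZuiddam2023, §1.1] -/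
theorem cwPow_five_restrictsTo_unitEightyFour :
    TensorRestrictsTo (kroneckerPow (cwTensor ℂ 2) 5) (unitTensor ℂ 84) :=
  diagonal_mul cwPow_three_restrictsTo_unitFourteen cwPow_two_restrictsTo_unitSix_complex

/-- `cw₂^{⊠6} ≥ ⟨216⟩` (`= ⟨6⟩^{⊠3}`, beating `⟨14⟩ ⊠ ⟨14⟩ = ⟨196⟩`; ceiling `697`).
[cite: ChristandlVranaZuiddam2023, §1.1] -/
theorem cwPow_six_restrictsTo_unitTwoHundredSixteen :
    TensorRestrictsTo (kroneckerPow (cwTensor ℂ 2) 6) (unitTensor ℂ 216) :=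
  diagonal_mul cwPow_four_restrictsTo_unitThirtySix cwPow_two_restrictsTo_unitSix_complex

/-- The subrank floors `36 ≤ Q(cw₂^{⊠4})`, `84 ≤ Q(cw₂^{⊠5})`, `216 ≤ Q(cw₂^{⊠6})` over `ℂ`.
[cite: ChristandlVranaZuiddam2023, §1.1] -/
theorem subrank_floors :
    36 ≤ subrank ℂ (kroneckerPow (cwTensor ℂ 2) 4) ∧
      84 ≤ subrank ℂ (kroneckerPow (cwTensor ℂ 2) 5) ∧
        216 ≤ subrank ℂ (kroneckerPow (cwTensor ℂ 2) 6) :=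
  ⟨Literature.Barriers.MatrixMultiplication.le_subrank_of_restrictsTo
      cwPow_four_restrictsTo_unitThirtySix,
    Literature.Barriers.MatrixMultiplication.le_subrank_of_restrictsTo
      cwPow_five_restrictsTo_unitEightyFour,
    Literature.Barriers.MatrixMultiplication.le_subrank_of_restrictsTo
      cwPow_six_restrictsTo_unitTwoHundredSixteen⟩

/-! ## 3. Single-matrix floors `M(4) ≥ 4`, `M(5) ≥ 6`, `M(6) ≥ 9` -/

/-- `I(4,4)`: `⟨4,4,4⟩ ≤ cw₂^{⊠4}` (`= I(2,2)^{⊠2}`; ceiling `M(4) ≤ 8`, exact value open).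
[cite: CoppersmithWinograd1990, §6] -/
theorem mmInCwTwoPow_four_four :
    TensorRestrictsTo (kroneckerPow (cwTensor ℂ 2) 4) (matMulTensor ℂ 4 4 4) :=
  mm_mul mmInCwTwoPow_two_two mmInCwTwoPow_two_two

/-- `I(5,6)`: `⟨6,6,6⟩ ≤ cw₂^{⊠5}` (`= I(2,2) ⊠ I(3,3)`; ceiling `M(5) ≤ 15`).
[cite: CoppersmithWinograd1990, §6] -/
theorem mmInCwTwoPow_five_six :
    TensorRestrictsTo (kroneckerPow (cwTensor ℂ 2) 5) (matMulTensor ℂ 6 6 6) :=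
  mm_mul mmInCwTwoPow_two_two (mmInCwTwoPow_three_three ℂ)

/-- `I(6,9)`: `⟨9,9,9⟩ ≤ cw₂^{⊠6}` (`= I(3,3)^{⊠2}`; ceiling `M(6) ≤ 26`,
`OutsiderSandwich.cwTwoNoExactPerfection_holds`). [cite: CoppersmithWinograd1990, §6] -/
theorem mmInCwTwoPow_six_nine :
    TensorRestrictsTo (kroneckerPow (cwTensor ℂ 2) 6) (matMulTensor ℂ 9 9 9) :=
  mm_mul (mmInCwTwoPow_three_three ℂ) (mmInCwTwoPow_three_three ℂ)

/-! ## 4. Packing floors (the table of the module docstring) -/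

/-- `(3,2)`: `3·⟨2,2,2⟩ ≤ cw₂^{⊠3}` (ceiling `5`, `OutsiderSandwichPencilSlack`).
[cite: ConnerGesmundoLandsbergVentura2022, eq. (1)] -/
theorem pack_three_two_le_cwPow_three :
    TensorRestrictsTo (kroneckerPow (cwTensor ℂ 2) 3)
      (kroneckerTensor (unitTensor ℂ 3) (matMulTensor ℂ 2 2 2)) :=
  pack_two_of_diagonal cwPow_two_restrictsTo_unitSix_complex

/-- `(4,2)`: `7·⟨2,2,2⟩ ≤ cw₂^{⊠4}` (from `⟨14⟩ ≤ cw₂^{⊠3}`; ceiling `17`).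
[cite: ConnerGesmundoLandsbergVentura2022, eq. (1)] -/
theorem pack_seven_two_le_cwPow_four :
    TensorRestrictsTo (kroneckerPow (cwTensor ℂ 2) 4)
      (kroneckerTensor (unitTensor ℂ 7) (matMulTensor ℂ 2 2 2)) :=
  pack_two_of_diagonal cwPow_three_restrictsTo_unitFourteen

/-- `(5,2)`: `18·⟨2,2,2⟩ ≤ cw₂^{⊠5}` (from `⟨36⟩ ≤ cw₂^{⊠4}`; ceiling `55`).
[cite: ConnerGesmundoLandsbergVentura2022, eq. (1)] -/
theorem pack_eighteen_two_le_cwPow_five :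
    TensorRestrictsTo (kroneckerPow (cwTensor ℂ 2) 5)
      (kroneckerTensor (unitTensor ℂ 18) (matMulTensor ℂ 2 2 2)) :=
  pack_two_of_diagonal cwPow_four_restrictsTo_unitThirtySix

/-- `(6,2)`: `42·⟨2,2,2⟩ ≤ cw₂^{⊠6}` (from `⟨84⟩ ≤ cw₂^{⊠5}`; ceiling `170`).
[cite: ConnerGesmundoLandsbergVentura2022, eq. (1)] -/
theorem pack_fortytwo_two_le_cwPow_six :
    TensorRestrictsTo (kroneckerPow (cwTensor ℂ 2) 6)
      (kroneckerTensor (unitTensor ℂ 42) (matMulTensor ℂ 2 2 2)) :=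
  pack_two_of_diagonal cwPow_five_restrictsTo_unitEightyFour

/-- `(4,3)`: `2·⟨3,3,3⟩ ≤ cw₂^{⊠4}` (ceiling `7`).
[cite: ConnerGesmundoLandsbergVentura2022, eq. (1)] -/
theorem pack_two_three_le_cwPow_four :
    TensorRestrictsTo (kroneckerPow (cwTensor ℂ 2) 4)
      (kroneckerTensor (unitTensor ℂ 2) (matMulTensor ℂ 3 3 3)) :=
  pack_of_diagonal_of_mm cwPow_one_restrictsTo_unitTwo (mmInCwTwoPow_three_three ℂ)

/-- `(5,3)`: `6·⟨3,3,3⟩ ≤ cw₂^{⊠5}` (ceiling `24`).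
[cite: ConnerGesmundoLandsbergVentura2022, eq. (1)] -/
theorem pack_six_three_le_cwPow_five :
    TensorRestrictsTo (kroneckerPow (cwTensor ℂ 2) 5)
      (kroneckerTensor (unitTensor ℂ 6) (matMulTensor ℂ 3 3 3)) :=
  pack_of_diagonal_of_mm cwPow_two_restrictsTo_unitSix_complex (mmInCwTwoPow_three_three ℂ)

/-- `(6,3)`: `14·⟨3,3,3⟩ ≤ cw₂^{⊠6}` (ceiling `75`).
[cite: ConnerGesmundoLandsbergVentura2022, eq. (1)] -/
theorem pack_fourteen_three_le_cwPow_six :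
    TensorRestrictsTo (kroneckerPow (cwTensor ℂ 2) 6)
      (kroneckerTensor (unitTensor ℂ 14) (matMulTensor ℂ 3 3 3)) :=
  pack_of_diagonal_of_mm cwPow_three_restrictsTo_unitFourteen (mmInCwTwoPow_three_three ℂ)

/-- `(7,3)`: `36·⟨3,3,3⟩ ≤ cw₂^{⊠7}` (ceiling `232`).
[cite: ConnerGesmundoLandsbergVentura2022, eq. (1)] -/
theorem pack_thirtysix_three_le_cwPow_seven :
    TensorRestrictsTo (kroneckerPow (cwTensor ℂ 2) 7)
      (kroneckerTensor (unitTensor ℂ 36) (matMulTensor ℂ 3 3 3)) :=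
  pack_of_diagonal_of_mm cwPow_four_restrictsTo_unitThirtySix (mmInCwTwoPow_three_three ℂ)

/-- `(5,4)`: `2·⟨4,4,4⟩ ≤ cw₂^{⊠5}` (ceiling `13`).
[cite: ConnerGesmundoLandsbergVentura2022, eq. (1)] -/
theorem pack_two_four_le_cwPow_five :
    TensorRestrictsTo (kroneckerPow (cwTensor ℂ 2) 5)
      (kroneckerTensor (unitTensor ℂ 2) (matMulTensor ℂ 4 4 4)) :=
  pack_of_diagonal_of_mm cwPow_one_restrictsTo_unitTwo mmInCwTwoPow_four_four

/-- `(6,4)`: `6·⟨4,4,4⟩ ≤ cw₂^{⊠6}` (ceiling `42`).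
[cite: ConnerGesmundoLandsbergVentura2022, eq. (1)] -/
theorem pack_six_four_le_cwPow_six :
    TensorRestrictsTo (kroneckerPow (cwTensor ℂ 2) 6)
      (kroneckerTensor (unitTensor ℂ 6) (matMulTensor ℂ 4 4 4)) :=
  pack_of_diagonal_of_mm cwPow_two_restrictsTo_unitSix_complex mmInCwTwoPow_four_four

end Summit.MatrixMultiplication.MatrixMultiplication.Theorems.OutsiderSandwichPackFloors
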